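import Literature.MathematicalPhysics.QuantumFieldTheory.Balaban1983to89.B11Eq98V0LettersPerLattice

/-!
# `Balaban1983to89.B11Eq98V0LettersUniform` — T. Bałaban, *The variational problem and background fields in renormalization group method for
# lattice gauge theories*, Commun. Math. Phys. **102** (1985) 277–309 [Balaban1985Variational]: (90)–(96) pp. 291–292 (the V₀-group of `(δ/δA′)V`),
# (38) p. 284, (98) p. 293 — THE V₀-GROUP's (98)-LETTER `C_V` CHOSEN BEFORE THE BACKGROUND: for unit-bounded unitary bond variables and a
# contractive tracial `*`-trace, ONE constant `C_V(lattice, ρ, τ)` serves `QuadAnalytic (curV0 ρ τ U₀) C_V (1/16)` for EVERY such background `U₀`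

statement-level skeleton of published theorems with citation tags; proofs where landed; nothing here is a claim about the Yang–Mills mass gap

PDF held: `paper:balaban1985-cmp102-variational-background` (journal page = PDF page + 276).  p. 293, Prop. 4: *«The constants a₃, C₄ depend on d and
L only.»* — WHAT IS PROVED HERE is NOT that uniformity in the lattice: it is uniformity IN THE BACKGROUND at a fixed finite lattice.

WHY THIS FILE (cell context).  NE9 leaf-01's `B11Eq98V0LettersPerLattice.exists_quadAnalytic_curV0` (gen 73) inhabits the two displayed letters of
ne9-leaf-05's `B11Eq63V0GroupCurrent.quadAnalytic_curV0` per lattice AND PER BACKGROUND: the level-geometry letter `Λ` (§1 there, background-free)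
and the (38)-trace letter `K` (§2 there, «a finite maximum over the plaquettes of ONE background»).  For a UNIT-BOUNDED background (`‖U₀(b)‖ ≤ 1`,
`‖U₀(b)⁻¹‖ ≤ 1` — the class `U1` of the NE9 chain) the plaquette variables are unit-bounded too, so `‖Re U₀(∂q) − 1‖ ≤ 2`, `‖Im U₀(∂q)‖ ≤ 1` and the
letter `K` can be taken BEFORE `∀ U₀`; with a contractive trace (`‖τ X‖ ≤ ‖X‖`, e.g. the normalised trace) the (31)-slots `‖τ(Z·U₀(∂q)^{±1})‖ ≤ ‖Z‖`
hold for every such background as well.  Consequence: the V₀-slot hypothesis `hqV : ‖curV0 ρ τ U Y‖ ≤ C_V‖Y‖²` on `‖Y‖ < R_V` displayed «at FIXED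
`(C_V, R_V)`» by the one-instance chart faces of the pub-balaban NE9 chain (`Support/NE9CurChartOneInstanceUniformBall` §3 and its small-bond ∕ END
twins) is DISCHARGED for all unit-bounded unitary backgrounds at once, with `R_V = 1/16`.

WHAT IS PROVED (sorry-free; [folklore] bookkeeping; 0 def, no `Prop` placeholder; nothing of [B11]'s inequalities asserted).
* §1 `plaqU_mem_U1` — plaquette variables of a `U1`-valued field lie in `U1` (subgroup closure); `norm_reC_sub_one_le_two`, `norm_imC_le_one_of_mem_U1`
  — `‖Re W − 1‖ ≤ 2`, `‖Im W‖ ≤ 1` for `W ∈ U1` (from the definitions `Re W = ½(W + W⁻¹)`, `Im W = (2i)⁻¹(W − W⁻¹)`).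
* §2 **`exists_traceSlotK_uniform`** — `∃ K ≥ 0` BEFORE `∀ U₀`: for every unit-bounded `U₀` the two (38)-type trace slots `hRe1`, `hIm` of
  `quadAnalytic_curV0` VERBATIM (`K = max K₁ K₂`, `K₁ ≥ 2‖τ‖·w_∂(q)²/η²`, `K₂ ≥ ‖τ‖·‖η⁻²‖·w_∂(q)²` for all plaquettes `q`).
* §3 **`traceSlotsW_of_contractive`** — the (31)-slots `hW`, `hW'` of `quadAnalytic_curV0` for every unit-bounded `U₀` from `‖τ X‖ ≤ ‖X‖` alone.
* §4 **`exists_quadAnalytic_curV0_uniform`** — `∃ C_V ≥ 0, ∀ U₀` unitary (`(U₀ b)⁻¹ = (U₀ b)*`) and unit-bounded, `QuadAnalytic (curV0 ρ τ U₀) C_V (1/16)`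
  (letters: `τ` tracial, `*`-compatible, contractive; `1 ≤ L`); **`exists_curV0_quadBound_uniform`** — the consumer-ready form `∃ C_V ≥ 0, ∀ U₀`
  (`U₀(b) ∈ U1`, `(U₀ b)* = (U₀ b)⁻¹`), `∀ Y, ‖Y‖ < 1/16 → ‖curV0 ρ τ U₀ Y‖ ≤ C_V‖Y‖²` — the NE9 one-instance faces' `hqV` at `(C_V, 1/16)`.
HONEST SCOPE.  PER-LATTICE constant (`Λ` = the worst weight ratio of ONE lattice's level maps; `K` ∝ the largest plaquette weight of that lattice ×
`‖τ‖`, `η⁻²`) — uniform in the BACKGROUND only; NO «d and L only», NO (38)∕(14) smallness.  NOT summit progress (cell pub-balaban: NE9 NOT PRINTED /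
NOT PROVED; «NE9 ⇐ the named binders»; spine PROVED 0/9; HONEST DEPENDENCY: continuum YM on T⁴ ⇐ BetaPertH ∧ nine spine estimates (0/9 proved);
BetaPertH ⇐ (D1) ∧ (D4) ∧ CAP+tail; G-an2-4 gates asym, D1 and NE2/3/4).  Filed by the NE9 leaf seat `b2b-balaban-t4-ne9-formalise-leaf-05` (gen 69);
NEW file importing NE9 leaf-01's `B11Eq98V0LettersPerLattice` ONLY; nothing modified.  Net new unproved facts: 0.
-/

noncomputable section

open scoped BigOperators
namespace Literature.MathematicalPhysics.QuantumFieldTheory.Balaban1983to89.B11Eq98V0LettersUniform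

open Literature.MathematicalPhysics.QuantumFieldTheory.Balaban1983to89.B9Eq37Insertion (reC imC)
open Literature.MathematicalPhysics.QuantumFieldTheory.Balaban1983to89.B9Eq39Adjoint (posPlaq plaqU)
open Literature.MathematicalPhysics.QuantumFieldTheory.Balaban1983to89.B11Eq90V0primeBond (plaqWeight plaqWeight_pos)
open Literature.MathematicalPhysics.QuantumFieldTheory.Balaban1983to89.B11Eq90V0primeCurrent (Tsh Ucur)
open Literature.MathematicalPhysics.QuantumFieldTheory.Balaban1983to89.B11Eq63V0GroupCurrent (curV0 quadAnalytic_curV0)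
open Literature.MathematicalPhysics.QuantumFieldTheory.Balaban1983to89.B11Eq98V0LettersPerLattice (exists_ratio_bound exists_levelGeometry)
open Literature.MathematicalPhysics.QuantumFieldTheory.Balaban1983to89.B13Contraction113 (QuadAnalytic)
open B7Prop1Explicit (U1 mem_U1)
open B9SectCLatticeCarrier (Bond)
open B4Sect5Torus (TSite)
open B11Eq115Space
open B11Eq111FrakG (nabla115)

/-! ## §1 Plaquette variables of a unit-bounded field; `Re`, `Im` on the unit-bounded class -/

section UnitBounded

variable {𝔸 : Type*} [NormedRing 𝔸] [NormedAlgebra ℂ 𝔸] [NormOneClass 𝔸]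

omit [NormedAlgebra ℂ 𝔸] in
/-- The plaquette variable `U₀(∂q) = U U U⁻¹ U⁻¹` of a `U1`-valued bond field lies in `U1` (`U1` is a subgroup of `𝔸ˣ`). [folklore]
[cite: Balaban1985BackgroundPropagators, (3.2) p.390] -/
theorem plaqU_mem_U1 {d : ℕ} {Pd : Fin d → ℕ} {U₀ : Bond d Pd → 𝔸ˣ} (hU1 : ∀ b, U₀ b ∈ U1 𝔸) (μ ν : Fin d) (x : TSite d Pd) :
    plaqU Tsh (Ucur U₀) μ ν x ∈ U1 𝔸 :=
  (U1 𝔸).mul_mem ((U1 𝔸).mul_mem ((U1 𝔸).mul_mem (hU1 _) (hU1 _)) ((U1 𝔸).inv_mem (hU1 _))) ((U1 𝔸).inv_mem (hU1 _))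

/-- `‖Re W − 1‖ ≤ 2` for `W ∈ U1` (`Re W = ½(W + W⁻¹)`, `‖W‖, ‖W⁻¹‖ ≤ 1`). [folklore] [cite: Balaban1985BackgroundPropagators, p.404 below (3.69)] -/
theorem norm_reC_sub_one_le_two {W : 𝔸ˣ} (hW : W ∈ U1 𝔸) : ‖reC W - 1‖ ≤ 2 := by
  obtain ⟨h1, h2⟩ := mem_U1.1 hW
  have hre : ‖reC W‖ ≤ 1 := by
    unfold reC
    calc ‖(2 : ℂ)⁻¹ • ((W : 𝔸) + ((W⁻¹ : 𝔸ˣ) : 𝔸))‖ = ‖(2 : ℂ)⁻¹‖ * ‖(W : 𝔸) + ((W⁻¹ : 𝔸ˣ) : 𝔸)‖ := norm_smul _ _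
      _ ≤ 2⁻¹ * (1 + 1) := by
          rw [norm_inv, Complex.norm_two]
          exact mul_le_mul_of_nonneg_left ((norm_add_le _ _).trans (add_le_add h1 h2)) (by norm_num)
      _ = 1 := by norm_num
  calc ‖reC W - 1‖ ≤ ‖reC W‖ + ‖(1 : 𝔸)‖ := norm_sub_le _ _
    _ ≤ 1 + 1 := add_le_add hre (le_of_eq norm_one)
    _ = 2 := by norm_num

/-- `‖Im W‖ ≤ 1` for `W ∈ U1` (`Im W = (2i)⁻¹(W − W⁻¹)`). [folklore] [cite: Balaban1985BackgroundPropagators, p.404 below (3.69)] -/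
theorem norm_imC_le_one_of_mem_U1 {W : 𝔸ˣ} (hW : W ∈ U1 𝔸) : ‖imC W‖ ≤ 1 := by
  obtain ⟨h1, h2⟩ := mem_U1.1 hW
  unfold imC
  calc ‖(2 * Complex.I)⁻¹ • ((W : 𝔸) - ((W⁻¹ : 𝔸ˣ) : 𝔸))‖ = ‖(2 * Complex.I)⁻¹‖ * ‖(W : 𝔸) - ((W⁻¹ : 𝔸ˣ) : 𝔸)‖ := norm_smul _ _
    _ ≤ 2⁻¹ * (1 + 1) := by
        rw [norm_inv, norm_mul, Complex.norm_two, Complex.norm_I, mul_one]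
        exact mul_le_mul_of_nonneg_left ((norm_sub_le _ _).trans (add_le_add h1 h2)) (by norm_num)
    _ = 1 := by norm_num

end UnitBounded

/-! ## §2 The (38)-trace letter `K` BEFORE the background, on the unit-bounded class -/

variable {d : ℕ} {Pd : Fin d → ℕ} {L η : ℝ} [Fact (0 < L)] [Fact (0 < η)]
variable {𝔸 : Type*} [NormedRing 𝔸] [NormedAlgebra ℂ 𝔸]

/-- **`∃ K ≥ 0` BEFORE `∀ U₀`: THE (38)-TYPE TRACE SLOTS OF `quadAnalytic_curV0` HOLD WITH ONE `K` FOR EVERY UNIT-BOUNDED BACKGROUND** —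
`‖τ(Z·(Re U₀(∂q) − 1))‖ ≤ ‖Z‖·η²·K/w_∂(q)²` and `‖τ(Z·η⁻²Im U₀(∂q))‖ ≤ ‖Z‖·K/w_∂(q)²` on the positively oriented plaquettes, for all `U₀` with
`‖U₀(b)‖, ‖U₀(b)⁻¹‖ ≤ 1`: `K` is `‖τ‖` times a finite maximum over the plaquette WEIGHTS of the lattice (§1: `‖Re W − 1‖ ≤ 2`, `‖Im W‖ ≤ 1` on `U1`);
print's (38)/(14) make `K` SMALL and lattice-uniform, which is NOT derived here. [cite: Balaban1985Variational, (38) p.284, (14) p.280, (90) p.291] -/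
theorem exists_traceSlotK_uniform [NormOneClass 𝔸] (τ : 𝔸 →L[ℂ] ℂ) (lev₀ : Bond d Pd → ℕ) :
    ∃ K : ℝ, 0 ≤ K ∧ ∀ (U₀ : Bond d Pd → 𝔸ˣ), (∀ b, ‖(U₀ b : 𝔸)‖ ≤ 1 ∧ ‖(((U₀ b)⁻¹ : 𝔸ˣ) : 𝔸)‖ ≤ 1) →
      (∀ q ∈ posPlaq (TSite d Pd) (Fin d), ∀ Z : 𝔸,
        ‖(τ : 𝔸 →ₗ[ℂ] ℂ) (Z * (reC (plaqU Tsh (Ucur U₀) q.2.1 q.2.2 q.1) - 1))‖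
          ≤ ‖Z‖ * (η ^ 2 * (K / plaqWeight Tsh (levWeight L η lev₀ 1) q ^ 2))) ∧
      (∀ q ∈ posPlaq (TSite d Pd) (Fin d), ∀ Z : 𝔸,
        ‖(τ : 𝔸 →ₗ[ℂ] ℂ) (Z * (((η : ℂ) ^ 2)⁻¹ • imC (plaqU Tsh (Ucur U₀) q.2.1 q.2.2 q.1)))‖
          ≤ ‖Z‖ * (K / plaqWeight Tsh (levWeight L η lev₀ 1) q ^ 2)) := by
  have hη : (0 : ℝ) < η := Fact.out
  have hw : ∀ b : Bond d Pd, 0 < levWeight L η lev₀ 1 b := levWeight_pos (Fact.out : 0 < L) hη lev₀ 1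
  have hpw : ∀ q, 0 < plaqWeight Tsh (levWeight L η lev₀ 1) q := plaqWeight_pos Tsh hw
  -- the generic estimate `‖τ(Z·X)‖ ≤ ‖τ‖·‖X‖·‖Z‖`
  have key : ∀ Z X : 𝔸, ‖(τ : 𝔸 →ₗ[ℂ] ℂ) (Z * X)‖ ≤ ‖τ‖ * ‖X‖ * ‖Z‖ := fun Z X => by
    calc ‖(τ : 𝔸 →ₗ[ℂ] ℂ) (Z * X)‖ = ‖τ (Z * X)‖ := rfl
      _ ≤ ‖τ‖ * ‖Z * X‖ := τ.le_opNorm _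
      _ ≤ ‖τ‖ * (‖Z‖ * ‖X‖) := by gcongr; exact norm_mul_le _ _
      _ = ‖τ‖ * ‖X‖ * ‖Z‖ := by ring
  -- background-FREE numerators: `2‖τ‖` and `‖τ‖·‖η⁻²‖`
  obtain ⟨K₁, hK₁, h₁⟩ := exists_ratio_bound (ι := TSite d Pd × Fin d × Fin d) (fun _ => ‖τ‖ * 2)
    (fun q => η ^ 2 / plaqWeight Tsh (levWeight L η lev₀ 1) q ^ 2) (fun q => by have := hpw q; positivity)
  obtain ⟨K₂, hK₂, h₂⟩ := exists_ratio_bound (ι := TSite d Pd × Fin d × Fin d) (fun _ => ‖τ‖ * (‖(((η : ℂ)) ^ 2)⁻¹‖ * 1))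
    (fun q => 1 / plaqWeight Tsh (levWeight L η lev₀ 1) q ^ 2) (fun q => by have := hpw q; positivity)
  refine ⟨max K₁ K₂, le_max_of_le_left (zero_le_one.trans hK₁), fun U₀ hUn => ⟨fun q _ Z => ?_, fun q _ Z => ?_⟩⟩
  · have hmem : plaqU Tsh (Ucur U₀) q.2.1 q.2.2 q.1 ∈ U1 𝔸 := plaqU_mem_U1 (fun b => mem_U1.2 (hUn b)) _ _ _
    calc _ ≤ ‖τ‖ * ‖reC (plaqU Tsh (Ucur U₀) q.2.1 q.2.2 q.1) - 1‖ * ‖Z‖ := key Z _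
      _ ≤ ‖τ‖ * 2 * ‖Z‖ := by gcongr; exact norm_reC_sub_one_le_two hmem
      _ ≤ K₁ * (η ^ 2 / plaqWeight Tsh (levWeight L η lev₀ 1) q ^ 2) * ‖Z‖ := mul_le_mul_of_nonneg_right (h₁ q) (norm_nonneg _)
      _ ≤ max K₁ K₂ * (η ^ 2 / plaqWeight Tsh (levWeight L η lev₀ 1) q ^ 2) * ‖Z‖ :=
          mul_le_mul_of_nonneg_right (mul_le_mul_of_nonneg_right (le_max_left _ _) (by have := hpw q; positivity)) (norm_nonneg _)
      _ = ‖Z‖ * (η ^ 2 * (max K₁ K₂ / plaqWeight Tsh (levWeight L η lev₀ 1) q ^ 2)) := by ring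
  · have hmem : plaqU Tsh (Ucur U₀) q.2.1 q.2.2 q.1 ∈ U1 𝔸 := plaqU_mem_U1 (fun b => mem_U1.2 (hUn b)) _ _ _
    have him : ‖((η : ℂ) ^ 2)⁻¹ • imC (plaqU Tsh (Ucur U₀) q.2.1 q.2.2 q.1)‖ ≤ ‖(((η : ℂ)) ^ 2)⁻¹‖ * 1 := by
      rw [norm_smul]; exact mul_le_mul_of_nonneg_left (norm_imC_le_one_of_mem_U1 hmem) (norm_nonneg _)
    calc _ ≤ ‖τ‖ * ‖((η : ℂ) ^ 2)⁻¹ • imC (plaqU Tsh (Ucur U₀) q.2.1 q.2.2 q.1)‖ * ‖Z‖ := key Z _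
      _ ≤ ‖τ‖ * (‖(((η : ℂ)) ^ 2)⁻¹‖ * 1) * ‖Z‖ := by gcongr
      _ ≤ K₂ * (1 / plaqWeight Tsh (levWeight L η lev₀ 1) q ^ 2) * ‖Z‖ := mul_le_mul_of_nonneg_right (h₂ q) (norm_nonneg _)
      _ ≤ max K₁ K₂ * (1 / plaqWeight Tsh (levWeight L η lev₀ 1) q ^ 2) * ‖Z‖ :=
          mul_le_mul_of_nonneg_right (mul_le_mul_of_nonneg_right (le_max_right _ _) (by have := hpw q; positivity)) (norm_nonneg _)
      _ = ‖Z‖ * (max K₁ K₂ / plaqWeight Tsh (levWeight L η lev₀ 1) q ^ 2) := by ring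

/-! ## §3 The (31)-slots from a contractive trace, on the unit-bounded class -/

/-- **`‖τ(Z·U₀(∂q))‖ ≤ ‖Z‖` AND `‖τ(Z·U₀(∂q)⁻¹)‖ ≤ ‖Z‖` FOR EVERY UNIT-BOUNDED BACKGROUND** from a CONTRACTIVE trace (`‖τ X‖ ≤ ‖X‖`, e.g. the
normalised trace in the operator norm): the two (31)-slots `hW`, `hW'` of `quadAnalytic_curV0`. [cite: Balaban1985Variational, (31) p.282] -/
theorem traceSlotsW_of_contractive [NormOneClass 𝔸] (τ : 𝔸 →L[ℂ] ℂ) (hτ1 : ∀ X : 𝔸, ‖τ X‖ ≤ ‖X‖) {U₀ : Bond d Pd → 𝔸ˣ}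
    (hUn : ∀ b, ‖(U₀ b : 𝔸)‖ ≤ 1 ∧ ‖(((U₀ b)⁻¹ : 𝔸ˣ) : 𝔸)‖ ≤ 1) :
    (∀ q ∈ posPlaq (TSite d Pd) (Fin d), ∀ Z : 𝔸,
      ‖(τ : 𝔸 →ₗ[ℂ] ℂ) (Z * (plaqU Tsh (Ucur U₀) q.2.1 q.2.2 q.1 : 𝔸))‖ ≤ ‖Z‖) ∧
    (∀ q ∈ posPlaq (TSite d Pd) (Fin d), ∀ Z : 𝔸,
      ‖(τ : 𝔸 →ₗ[ℂ] ℂ) (Z * (((plaqU Tsh (Ucur U₀) q.2.1 q.2.2 q.1)⁻¹ : 𝔸ˣ) : 𝔸))‖ ≤ ‖Z‖) := by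
  have key : ∀ (Z X : 𝔸), ‖X‖ ≤ 1 → ‖(τ : 𝔸 →ₗ[ℂ] ℂ) (Z * X)‖ ≤ ‖Z‖ := fun Z X hX => by
    calc ‖(τ : 𝔸 →ₗ[ℂ] ℂ) (Z * X)‖ = ‖τ (Z * X)‖ := rfl
      _ ≤ ‖Z * X‖ := hτ1 _
      _ ≤ ‖Z‖ * ‖X‖ := norm_mul_le _ _
      _ ≤ ‖Z‖ * 1 := mul_le_mul_of_nonneg_left hX (norm_nonneg _)
      _ = ‖Z‖ := mul_one _
  refine ⟨fun q _ Z => ?_, fun q _ Z => ?_⟩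
  · exact key Z _ (mem_U1.1 (plaqU_mem_U1 (fun b => mem_U1.2 (hUn b)) _ _ _)).1
  · exact key Z _ (mem_U1.1 (plaqU_mem_U1 (fun b => mem_U1.2 (hUn b)) _ _ _)).2

/-! ## §4 The V₀-group's (98)-letter BEFORE the background -/

/-- **`∃ C_V ≥ 0, ∀ U₀` UNITARY UNIT-BOUNDED, `QuadAnalytic (curV0 ρ τ U₀) C_V (1/16)`** — ne9-leaf-05 g64's `quadAnalytic_curV0` with BOTH letters
chosen before the background: `Λ` by leaf-01's `exists_levelGeometry` (background-free) and `K` by §2 (one `K` on the unit-bounded class), the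
(31)-slots by §3; remaining letters: `τ` tracial, `*`-compatible and contractive, `1 ≤ L`.  `C_V = 1024(d−1)Λ³‖ρ‖(K + 1/16) + (d−1)Λ³(136 + 2Λ)‖ρ‖‖τ‖`
— a finite-lattice number, NOT print's «d and L only». [cite: Balaban1985Variational, (98) p.293, (90)–(96) pp.291–292] -/
theorem exists_quadAnalytic_curV0_uniform {lev₀ : Bond d Pd → ℕ} {lev₁ : Bond d Pd × Fin d → ℕ} [CompleteSpace 𝔸] [NormOneClass 𝔸] [StarRing 𝔸]
    [StarModule ℂ 𝔸] (ρ : (𝔸 →L[ℂ] ℂ) →L[ℂ] 𝔸) (τ : 𝔸 →L[ℂ] ℂ)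
    (hτ : ∀ a b : 𝔸, τ (a * b) = τ (b * a)) (hτs : ∀ a : 𝔸, τ (star a) = starRingEnd ℂ (τ a)) (hτ1 : ∀ X : 𝔸, ‖τ X‖ ≤ ‖X‖) (hL : 1 ≤ L) :
    ∃ CV : ℝ, 0 ≤ CV ∧ ∀ (U₀ : Bond d Pd → 𝔸ˣ), (∀ b, (((U₀ b)⁻¹ : 𝔸ˣ) : 𝔸) = star (U₀ b : 𝔸)) →
      (∀ b, ‖(U₀ b : 𝔸)‖ ≤ 1 ∧ ‖(((U₀ b)⁻¹ : 𝔸ˣ) : 𝔸)‖ ≤ 1) →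
      QuadAnalytic (curV0 (L := L) (η := η) (lev₀ := lev₀) (lev₁ := lev₁) (Dc := nabla115 η U₀) ρ τ U₀) CV (1 / 16) := by
  obtain ⟨Λ, hΛ1, hΛ, hΛa, hΛ'⟩ := exists_levelGeometry (L := L) (η := η) lev₀ lev₁
  obtain ⟨K, hK, HK⟩ := exists_traceSlotK_uniform (L := L) (η := η) τ lev₀
  have hΛ0 : 0 ≤ Λ := zero_le_one.trans hΛ1
  refine ⟨1024 * ((d - 1 : ℕ) : ℝ) * Λ ^ 3 * ‖ρ‖ * (K + 1 / 16) + ((d - 1 : ℕ) : ℝ) * Λ ^ 3 * (136 + 2 * Λ) * ‖ρ‖ * ‖τ‖, by positivity,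
    fun U₀ hU hUn => ?_⟩
  obtain ⟨hRe1, hIm⟩ := HK U₀ hUn
  obtain ⟨hW, hW'⟩ := traceSlotsW_of_contractive (d := d) (Pd := Pd) τ hτ1 hUn
  exact quadAnalytic_curV0 ρ τ U₀ hU hUn hτ hτs hL hK hΛ1 hΛ hΛa hΛ' hRe1 hIm hW hW'

/-- **THE CONSUMER-READY FORM — THE NE9 ONE-INSTANCE FACES' `hqV` AT `(C_V, 1/16)` FOR EVERY UNIT-BOUNDED UNITARY BACKGROUND**: `∃ C_V ≥ 0, ∀ U₀`
with `U₀(b) ∈ U1` and `(U₀ b)* = (U₀ b)⁻¹`, `∀ Y, ‖Y‖ < 1/16 → ‖curV0 ρ τ U₀ Y‖ ≤ C_V‖Y‖²` (the `quad` field of §4; background class stated as in the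
chain's `hRS_of_unitary`). [cite: Balaban1985Variational, (98) p.293] -/
theorem exists_curV0_quadBound_uniform {lev₀ : Bond d Pd → ℕ} {lev₁ : Bond d Pd × Fin d → ℕ} [CompleteSpace 𝔸] [NormOneClass 𝔸] [StarRing 𝔸]
    [StarModule ℂ 𝔸] (ρ : (𝔸 →L[ℂ] ℂ) →L[ℂ] 𝔸) (τ : 𝔸 →L[ℂ] ℂ)
    (hτ : ∀ a b : 𝔸, τ (a * b) = τ (b * a)) (hτs : ∀ a : 𝔸, τ (star a) = starRingEnd ℂ (τ a)) (hτ1 : ∀ X : 𝔸, ‖τ X‖ ≤ ‖X‖) (hL : 1 ≤ L) :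
    ∃ CV : ℝ, 0 ≤ CV ∧ ∀ (U₀ : Bond d Pd → 𝔸ˣ), (∀ b, U₀ b ∈ U1 𝔸) → (∀ b, star (U₀ b : 𝔸) = (((U₀ b)⁻¹ : 𝔸ˣ) : 𝔸)) →
      ∀ Y : Space115 L η lev₀ lev₁ (nabla115 η U₀), ‖Y‖ < 1 / 16 →
        ‖curV0 (lev₁ := lev₁) (Dc := nabla115 η U₀) ρ τ U₀ Y‖ ≤ CV * ‖Y‖ ^ 2 := by
  obtain ⟨CV, hCV, H⟩ := exists_quadAnalytic_curV0_uniform (L := L) (η := η) (lev₀ := lev₀) (lev₁ := lev₁) ρ τ hτ hτs hτ1 hL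
  exact ⟨CV, hCV, fun U₀ hU1 hUstar Y hY => (H U₀ (fun b => (hUstar b).symm) (fun b => mem_U1.1 (hU1 b))).quad Y hY⟩

end Literature.MathematicalPhysics.QuantumFieldTheory.Balaban1983to89.B11Eq98V0LettersUniform

end
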